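import Literature.NumberTheory.GaloisRepresentations.IdeleTruncatedSShapiroComponents
import Literature.NumberTheory.GaloisRepresentations.IdeleTruncatedSLocalLayerClass
import Literature.NumberTheory.GaloisRepresentations.LocalUnitsLayerCompletionIso
import Literature.NumberTheory.GaloisRepresentations.IdeleTruncatedSLocalPlacesExhaust
import Literature.NumberTheory.GaloisRepresentations.SemiLocalArchimedeanShapiro
import HarnessLib

/-!
# [P2-mono], finite level — the assembly `eq_zero_of_forall_locLayerClass_eq_zero`: a class of `H²(H_E, Res J_{E,S})`
# all of whose local-layer data `locLayerClass (w,t)` vanish is zero (Harari Prop. 17.25 / Milne I Lemma 4.13 at `r = 2`,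
# read on a finite layer; Tate C–F VII §7.3)

Topic `NumberTheory/GaloisRepresentations`; namespaces `Literature.NumberTheory.GaloisRepresentations.IdeleHerbrand` (§1–§2),
`….IdeleReadout` (§3), `….IdeleClassBar` (§4, the export).  Sequel to this seat's `IdeleTruncatedSFiniteComponents` (Tate VII 7.3
for `J_{E,S}` at a subgroup: `eq_zero_of_placeComponents_eq_zero_above`) and `IdeleTruncatedSShapiroComponents`
(`shapiroAut_placeProj_truncComponentClass_eq_map`), to LEAD bsd-line-x1-p1's `IdeleTruncatedSLocalLayerClass` (`locLayerClass`),
bsd-line-x1-p1-w3's `LocalLayerTwistedRestriction` / `LocalUnitsLayerCompletionIso` (the local identification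
`locLayerCohomologyIsoAut : Hⁿ(V_v ⧸ N_{v,s}, (K̄_vˣ)^{N_{v,s}}) ≅ Hⁿ(Gal(E_{w_s}/L_u), E_{w_s}ˣ)` and its dictionaries),
bsd-line-x1-p1-w7's `IdeleTruncatedSLocalPlacesExhaust` (every finite place of `L = E^{H_E}` above `S` lies under some `w_{s_t}`) and
door-c5's `SemiLocalArchimedeanShapiro` (`isZero_groupCohomology_archUnitsRep`).  Theorems only; no named fact, no instance, no
notation, no `sorry`; number fields in `Type`.

* §1 generic: `map_map_map_map_map_eq_map_apply`, `iso_hom_map_map_iso_inv_eq_map_apply` (five `groupCohomology.map`s are one,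
  abstract `Rep`s), `iso_hom_apply_eq_zero_iff`.
* §2 **`infPlaceComponent_truncComponentClass_eq_zero_of_isTotallyComplex`**: over a TOTALLY COMPLEX base `K ⊆ L = E^H`, every
  archimedean component of (the image of) a class `c ∈ Hⁿ⁺¹(H, Res_H J_{E,S})` vanishes (every infinite place of `L` is complex,
  so unramified in `E`, and `Hⁿ⁺¹` of the trivial decomposition group is `0`); hence the criterion
  **`eq_zero_of_finitePlaceComponents_eq_zero_above`**: only the finite places of `L` above `S` need checking.
* §3 the `(w,t) ↔ u` matching: the group dictionary `truncLocGroupHom_eq_subgroupImageSEquiv` (`Gal(E_{w_s}/L_u) → H_E` IS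
  `subgroupImageSEquiv ∘ ψ̄_s ∘ locDecompEquiv⁻¹ ∘ decompMulEquiv⁻¹`), the module dictionary `truncLocCoeffHom_hom_eq_locUnitsEquiv`
  (`x ↦ x_{w_s}` IS `locUnitsEquiv ∘ conjCoeff^N ∘ comapLayerHom ∘ relLayerISEquiv⁻¹`: Tate's `(σ x)_{σ w} = σ_w x_w` through
  door-c6's canonical idèle projection), the square **`locLayerCohomologyIsoAut_hom_locLayerClass_eq_map`**
  (`locLayerCohomologyIsoAut (locLayerClass (inr v, t) c) = Hⁿ(truncLocGroupHom, truncLocCoeffHom) c`), and its vanishing form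
  `placeComponent_truncComponentClass_eq_zero_of_locLayerClass_eq_zero`.
* §4 THE EXPORT **`IdeleClassBar.eq_zero_of_forall_locLayerClass_eq_zero`** `[IsTotallyComplex K] [U.Normal]`: for every layer
  `E ⊆ K_S` with `V̄_E ≤ U` and every `c ∈ H²(H_E, Res_{H_E} J_{E,S})`, if `locLayerClass K S U w t hE hEU 2 c = 0` for all
  `w ∣ S ∪ ∞` and all double cosets `t`, then `c = 0` — the hypothesis `hfinite` of LEAD's `IdeleTruncatedSLocalInjectivityTwo`.

HONEST FRAMING: bookkeeping over Tate's theorem `H²(Gal(E/L), J_{E,S}) ↪ ⊕ H²(G_w, E_wˣ)`; no case of Poitou–Tate and nothing about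
BSD is proved here.  Cell `bsd-eis`, crux `GoodLatticeBDPValue` (stmt-BirchSwinnertonDyer-19032), brick E3/[P2-mono] file P2-b(ii),
seat bsd-line-x1-p1-w8 g13.

## References
* J. W. S. Cassels, A. Fröhlich (eds.), *Algebraic Number Theory* (1967), Ch. VII (J. Tate) §1.1, §7.2–§7.3 Prop. 7.3. [CasselsFrohlichANT1967]
* D. Harari, *Galois Cohomology and Class Field Theory*, Universitext (2020), §13.1 Prop. 13.1 (b), §17.5 Lemma 17.23, Prop. 17.25. [Harari2020]
* J. S. Milne, *Arithmetic Duality Theorems*, 2nd ed. (2006), I Lemma 4.13. [MilneADT2006]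
* J.-P. Serre, *Galois Cohomology* (1997), I §2.4. [SerreGaloisCohomology1997]
-/

noncomputable section

open NumberField IsDedekindDomain CategoryTheory CategoryTheory.Limits groupCohomology
open Literature.NumberTheory.Automorphic

namespace Literature.NumberTheory.GaloisRepresentations

namespace IdeleHerbrand

open SemiLocal Literature.Algebra.Homology IdeleCohomology

/-! ## §1. Five `groupCohomology.map`s are one -/

/-- **Bookkeeping over abstract representations**: `Hⁿ(g₅, χ₅) ∘ ⋯ ∘ Hⁿ(g₁, χ₁) = Hⁿ(f, θ)` when `f = g₁ ∘ ⋯ ∘ g₅` pointwise and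
`θ = χ₅ ∘ ⋯ ∘ χ₁` on vectors (Mathlib `groupCohomology.map_comp`, door-c5/c6 `map_congr'`; the four-map form is this seat's
`IdeleCohomology.map_map_map_eq_map_apply` pattern). [cite: SerreGaloisCohomology1997, I §2.4] -/
theorem map_map_map_map_map_eq_map_apply {G₀ G₁ G₂ G₃ G₄ G₅ : Type} [Group G₀] [Group G₁] [Group G₂] [Group G₃] [Group G₄]
    [Group G₅] {A : Rep ℤ G₀} {B : Rep ℤ G₁} {C : Rep ℤ G₂} {D : Rep ℤ G₃} {D' : Rep ℤ G₄} {T : Rep ℤ G₅}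
    (g₁ : G₁ →* G₀) (χ₁ : Rep.res g₁ A ⟶ B) (g₂ : G₂ →* G₁) (χ₂ : Rep.res g₂ B ⟶ C)
    (g₃ : G₃ →* G₂) (χ₃ : Rep.res g₃ C ⟶ D) (g₄ : G₄ →* G₃) (χ₄ : Rep.res g₄ D ⟶ D') (g₅ : G₅ →* G₄) (χ₅ : Rep.res g₅ D' ⟶ T)
    (f : G₅ →* G₀) (θ : Rep.res f A ⟶ T) (hf : ∀ x, f x = g₁ (g₂ (g₃ (g₄ (g₅ x)))))
    (hθ : ∀ a : A.V, θ.hom a = χ₅.hom (χ₄.hom (χ₃.hom (χ₂.hom (χ₁.hom a))))) (n : ℕ) (c : groupCohomology A n) :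
    groupCohomology.map g₅ χ₅ n (groupCohomology.map g₄ χ₄ n (groupCohomology.map g₃ χ₃ n (groupCohomology.map g₂ χ₂ n
      (groupCohomology.map g₁ χ₁ n c)))) = groupCohomology.map f θ n c := by
  letI := A.hV2
  letI := T.hV2
  have key : groupCohomology.map g₁ χ₁ n ≫ groupCohomology.map g₂ χ₂ n ≫ groupCohomology.map g₃ χ₃ n ≫
      groupCohomology.map g₄ χ₄ n ≫ groupCohomology.map g₅ χ₅ n = groupCohomology.map f θ n := by
    rw [← groupCohomology.map_comp, ← groupCohomology.map_comp, ← groupCohomology.map_comp, ← groupCohomology.map_comp]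
    exact map_congr' (MonoidHom.ext fun x => (hf x).symm) _ _ (fun a => (hθ a).symm) n
  have h := congrArg (fun F => (ConcreteCategory.hom F) c) key
  simpa only [ModuleCat.hom_comp, LinearMap.coe_comp, Function.comp_apply] using h

/-- The same in the shape LEAD bsd-line-x1-p1's `locLayerClass` is consumed (§3): the outer two maps packaged as the `hom` of a
composite of two isomorphisms and the innermost as the `inv` of an isomorphism (`Iso.trans_hom`, then the five-map form).
[cite: SerreGaloisCohomology1997, I §2.4] -/
theorem iso_hom_map_map_iso_inv_eq_map_apply {G₀ G₁ G₂ G₃ G₄ G₅ : Type} [Group G₀] [Group G₁] [Group G₂] [Group G₃]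
    [Group G₄] [Group G₅] {A : Rep ℤ G₀} {B : Rep ℤ G₁} {C : Rep ℤ G₂} {D : Rep ℤ G₃} {D' : Rep ℤ G₄} {T : Rep ℤ G₅}
    (g₁ : G₁ →* G₀) (χ₁ : Rep.res g₁ A ⟶ B) (g₂ : G₂ →* G₁) (χ₂ : Rep.res g₂ B ⟶ C)
    (g₃ : G₃ →* G₂) (χ₃ : Rep.res g₃ C ⟶ D) (g₄ : G₄ →* G₃) (χ₄ : Rep.res g₄ D ⟶ D') (g₅ : G₅ →* G₄) (χ₅ : Rep.res g₅ D' ⟶ T)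
    (f : G₅ →* G₀) (θ : Rep.res f A ⟶ T) (hf : ∀ x, f x = g₁ (g₂ (g₃ (g₄ (g₅ x)))))
    (hθ : ∀ a : A.V, θ.hom a = χ₅.hom (χ₄.hom (χ₃.hom (χ₂.hom (χ₁.hom a))))) (n : ℕ)
    (I₁ : groupCohomology B n ≅ groupCohomology A n) (hI₁ : I₁.inv = groupCohomology.map g₁ χ₁ n)
    (I₄ : groupCohomology D n ≅ groupCohomology D' n) (hI₄ : I₄.hom = groupCohomology.map g₄ χ₄ n)
    (I₅ : groupCohomology D' n ≅ groupCohomology T n) (hI₅ : I₅.hom = groupCohomology.map g₅ χ₅ n)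
    (c : groupCohomology A n) :
    (I₄ ≪≫ I₅).hom (groupCohomology.map g₃ χ₃ n (groupCohomology.map g₂ χ₂ n (I₁.inv c))) =
      groupCohomology.map f θ n c := by
  rw [Iso.trans_hom, CategoryTheory.comp_apply, hI₁, hI₄, hI₅]
  exact map_map_map_map_map_eq_map_apply g₁ χ₁ g₂ χ₂ g₃ χ₃ g₄ χ₄ g₅ χ₅ f θ hf hθ n c

/-- An isomorphism of `ℤ`-modules (e.g. a Shapiro isomorphism of cohomology groups) detects `0` (abstract form, so that the
instance at a concrete cohomology group is found by first-order matching). [cite: CasselsFrohlichANT1967, Ch. VII §7.2] -/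
theorem iso_hom_apply_eq_zero_iff {M N : ModuleCat ℤ} (e : M ≅ N) (x : M) : e.hom x = 0 ↔ x = 0 := by
  constructor
  · intro h
    have h' := congrArg e.inv h
    rwa [Iso.hom_inv_id_apply, map_zero] at h'
  · rintro rfl
    exact map_zero _

/-! ## §2. Totally complex base: the archimedean components vanish -/

variable {F : Type} [Field F] [NumberField F] {E : Type} [Field E] [NumberField E] [Algebra F E] [IsGalois F E]
variable (S : Finset (HeightOneSpectrum (𝓞 F))) (H : Subgroup (E ≃ₐ[F] E))

omit [NumberField F] [NumberField E] [IsGalois F E] in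
/-- Over a totally complex `F`, every infinite place of `E` is unramified over every intermediate field `L` (its restriction to
`L` is complex, as it restricts further to a complex place of `F`). [cite: Harari2020, §13.1 Prop. 13.1 (b) (proof)] -/
theorem isUnramified_infinitePlace_of_isTotallyComplex [IsTotallyComplex F] (L : IntermediateField F E) (w₀ : InfinitePlace E) :
    InfinitePlace.IsUnramified L w₀ := by
  rw [InfinitePlace.isUnramified_iff]
  refine Or.inr (InfinitePlace.not_isReal_iff_isComplex.mp fun hreal => ?_)
  exact InfinitePlace.not_isReal_iff_isComplex.mpr (IsTotallyComplex.isComplex _) (hreal.comap (algebraMap F L))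

/-- **Totally complex base: the archimedean components of a class from `Hⁿ⁺¹(H, Res_H J_{E,S})` vanish**: for `L = E^H` and an
infinite place `u` of `L`, `Hⁿ⁺¹(Gal(E/L), ∏_{w∣u} E_wˣ) = 0` (the place is complex, the decomposition group trivial; door-c5
`isZero_groupCohomology_archUnitsRep`). [cite: Harari2020, §13.1 Prop. 13.1 (b)][cite: CasselsFrohlichANT1967, Ch. VII §7.3] -/
theorem infPlaceComponent_truncComponentClass_eq_zero_of_isTotallyComplex [IsTotallyComplex F] (n : ℕ)
    (c : groupCohomology (Rep.res H.subtype (truncRep F E S)) (n + 1))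
    (u : InfinitePlace (IntermediateField.fixedField H)) :
    groupCohomology.map (MonoidHom.id _) (infPlaceProj (E := E) u) (n + 1) (truncComponentClass S H (n + 1) c) = 0 := by
  haveI : Algebra.IsAlgebraic (IntermediateField.fixedField H) E := Algebra.IsAlgebraic.of_finite _ E
  obtain ⟨w₀, rfl⟩ := InfinitePlace.comap_surjective (k := IntermediateField.fixedField H) (K := E) u
  haveI : Fintype (E ≃ₐ[IntermediateField.fixedField H] E) := Fintype.ofFinite _
  haveI := ModuleCat.subsingleton_of_isZero
    (ArchHerbrand.isZero_groupCohomology_archUnitsRep (F := IntermediateField.fixedField H) w₀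
      (isUnramified_infinitePlace_of_isTotallyComplex (IntermediateField.fixedField H) w₀) n)
  exact Subsingleton.elim _ _

/-- **Over a totally complex base only the finite places above `S` matter**: a class `c ∈ Hⁿ⁺¹(H, Res_H J_{E,S})` is zero as soon as
its components at the finite places of `L = E^H` above `S` vanish. [cite: CasselsFrohlichANT1967, Ch. VII §7.3 Prop. 7.3]
[cite: Harari2020, §13.1 Prop. 13.1 (b), §17.5 Prop. 17.25] -/
theorem eq_zero_of_finitePlaceComponents_eq_zero_above [IsTotallyComplex F] (n : ℕ)
    (c : groupCohomology (Rep.res H.subtype (truncRep F E S)) (n + 1))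
    (hfin : ∀ u : HeightOneSpectrum (𝓞 (IntermediateField.fixedField H)), u.under (𝓞 F) ∈ S →
      groupCohomology.map (MonoidHom.id _) (placeProj (E := E) u) (n + 1) (truncComponentClass S H (n + 1) c) = 0) :
    c = 0 :=
  eq_zero_of_placeComponents_eq_zero_above S H (n + 1) c hfin
    fun u => infPlaceComponent_truncComponentClass_eq_zero_of_isTotallyComplex S H n c u

end IdeleHerbrand

/-! ## §3. Matching LEAD bsd-line-x1-p1's `locLayerClass (w,t)` with the place components (the `(w,t) ↔ u` square) -/

namespace IdeleReadout

open IdeleClassBar SemiLocal DiscreteGaloisModule Literature.Algebra.Homology.DiscreteRep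
open Literature.NumberTheory.GaloisRepresentations.LocalWeilDatum (galFixing)

variable (K : Type) [Field K] [NumberField K] (S : Finset (HeightOneSpectrum (𝓞 K)))
  (U : Subgroup (GaloisGroupUnramifiedOutside K (↑S : Set (HeightOneSpectrum (𝓞 K))))) [hUn : U.Normal]
  {E : GalLayer K}
  (hE : ramificationSubgroup K (↑S : Set (HeightOneSpectrum (𝓞 K))) ≤ galFixing K E.1)
  (hEU : (layerSubgroupS S E : Subgroup (GaloisGroupUnramifiedOutside K (↑S : Set (HeightOneSpectrum (𝓞 K))))) ≤ U)
  (v : HeightOneSpectrum (𝓞 K)) (s : GaloisGroupUnramifiedOutside K (↑S : Set (HeightOneSpectrum (𝓞 K))))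
  (u : HeightOneSpectrum (𝓞 (locFixedField K S U hE)))
  (hu : haveI := E.numberField; haveI := E.isGalois;
    (locPlace K S hE v s : HeightOneSpectrum (𝓞 E.1)).under (𝓞 (locFixedField K S U hE)) = u)

/-- **Group dictionary**: bsd-line-x1-p1-w8's `truncLocGroupHom H_E w_s : Gal(E_{w_s}/L_u) →* H_E` IS the composite
`Gal(E_{w_s}/L_u) ≃ G_{w_s}(E/L) ≃ V_v ⧸ N_{v,s} → ↥U ⧸ (V̄_E ∩ U) ≃ H_E` of door-c5's `decompMulEquiv⁻¹`, bsd-line-x1-p1-w3's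
`locDecompEquiv⁻¹`, -w7's `quotComapMap ψ_s` and -w3 g17's `subgroupImageSEquiv` (both are `g ↦ ρ_s(d)` for any `d ∈ V_v` over `g`).
[cite: CasselsFrohlichANT1967, Ch. VII §1.1][cite: Harari2020, §17.5 Lemma 17.23] -/
theorem truncLocGroupHom_eq_subgroupImageSEquiv
    (g : haveI := E.numberField; haveI := E.isGalois;
      ((locPlaceOver K S U hE v s u hu : HeightOneSpectrum (𝓞 E.1)).adicCompletion E.1) ≃ₐ[u.adicCompletion (locFixedField K S U hE)]
        ((locPlaceOver K S U hE v s u hu : HeightOneSpectrum (𝓞 E.1)).adicCompletion E.1)) :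
    haveI := E.numberField; haveI := E.isGalois;
    IdeleHerbrand.truncLocGroupHom (subgroupImageS S hE U) (locPlaceOver K S U hE v s u hu) g =
      subgroupImageSEquiv S hE U
        (quotComapMap (conjHom (decompMapPlaceS K S (Sum.inr v : Place K)) U s)
          (continuous_conjHom (decompMapPlaceS K S (Sum.inr v : Place K)) (continuous_decompMapPlaceS K S _) U s)
          (traceOpenNormalSubgroup U (layerSubgroupS S E))
          ((locDecompEquiv K S U hE hEU v s u hu).symm ((decompMulEquiv (locPlaceOver K S U hE v s u hu)).symm g))) := by
  haveI := E.numberField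
  haveI := E.isGalois
  generalize hq : (locDecompEquiv K S U hE hEU v s u hu).symm ((decompMulEquiv (locPlaceOver K S U hE v s u hu)).symm g) = q
  induction q using QuotientGroup.induction_on with
  | H d =>
    -- `locDecompEquiv [d] = decompMulEquiv⁻¹ g`, i.e. `locDecompHom d` IS `g` read in `G_{w_s}(E/L)`
    have hτ : locDecompEquiv K S U hE hEU v s u hu (QuotientGroup.mk d) =
        (decompMulEquiv (locPlaceOver K S U hE v s u hu)).symm g := (MulEquiv.eq_symm_apply _).1 hq.symm
    refine Subtype.ext ?_
    -- both sides, as `K`-automorphisms of `E`, are `ρ_s(d) = (ψ_s d)|_E` (no `rw`: explicit chain)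
    exact ((congrArg (fun τ : MulAction.stabilizer (E.1 ≃ₐ[locFixedField K S U hE] E.1) (locPlaceOver K S U hE v s u hu) =>
        AlgEquiv.restrictScalars K (τ : E.1 ≃ₐ[locFixedField K S U hE] E.1)) hτ).symm.trans
      ((restrictScalars_locDecompHom K S U hE v s u hu d).trans (locRestrict_eq_restrictHomS_conjHom K S U hE v s d)))

/-- **Module dictionary**: on a truncated idèle `x ∈ J_{E,S}`, bsd-line-x1-p1-w8's `truncLocCoeffHom` (`x ↦ x_{w_s}`) IS the
composite of P2-a's `relLayerISEquiv⁻¹` (`x ↦ [x]_E`), -w7's `comapLayerHom` (identity on vectors), the layer of -w4's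
`conjCoeff` (`b ↦ π_v(s⁻¹ • b)`) and -w3's `locUnitsEquiv` (`placeEmb⁻¹`): Tate's `(σ x)_{σ w} = σ_w(x_w)` read through door-c6's
canonical idèle projection (`finIdelePi_of`, `coe_unitsVal_idelePlaceReadout`) and -w3's `placeEmb_twistEmb_eq` / `coe_locPlace_eq_smul`.
[cite: CasselsFrohlichANT1967, Ch. VII §1.1, §7.3][cite: Harari2020, §17.5 Prop. 17.25 (proof)] -/
theorem truncLocCoeffHom_hom_eq_locUnitsEquiv (hv : v ∈ S)
    (x : haveI := E.numberField; haveI := E.isGalois; (IdeleHerbrand.truncRep K E.1 S).V) :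
    haveI := E.numberField; haveI := E.isGalois;
    (IdeleHerbrand.truncLocCoeffHom S (subgroupImageS S hE U) (locPlaceOver K S U hE v s u hu)).hom x =
      locUnitsEquiv K S U hE hEU v s u hu
        (((invariantsQuotFunctor ℤ
            (comapOpenNormalSubgroup (conjHom (decompMapPlaceS K S (Sum.inr v : Place K)) U s)
              (continuous_conjHom (decompMapPlaceS K S (Sum.inr v : Place K)) (continuous_decompMapPlaceS K S _) U s)
              (traceOpenNormalSubgroup U (layerSubgroupS S E)) : Subgroup ↥(U.comap (decompMapPlaceS K S (Sum.inr v : Place K))))).map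
          (conjCoeff (decompMapPlaceS K S (Sum.inr v : Place K)) (continuous_decompMapPlaceS K S _) U (truncIdeleBarD K S)
            (unitsD (Place.Completion (Sum.inr v : Place K))) (locQ K S ⟨Sum.inr v, hv⟩) s (k := ℤ))).hom
          ((comapLayerHom (conjHom (decompMapPlaceS K S (Sum.inr v : Place K)) U s)
              (continuous_conjHom (decompMapPlaceS K S (Sum.inr v : Place K)) (continuous_decompMapPlaceS K S _) U s)
              (traceOpenNormalSubgroup U (layerSubgroupS S E)) ((resD ℤ U).obj (truncIdeleBarD K S))).hom
            ((relLayerISEquiv S U hE hEU).symm x))) := by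
  haveI := E.numberField
  haveI := E.isGalois
  induction s using QuotientGroup.induction_on with
  | H σ =>
    refine (Additive.toMul.injective ((toMul_locUnitsEquiv_eq_iff' K S U hE hEU v _ u hu _ _).2 ?_)).symm
    -- LHS: `placeEmb_{ι_s} (x_{w_s}) = placeEmb_ι ((g_s⁻¹)_* x_{w_s})` (-w3 §2b)
    refine (placeEmb_twistEmb_eq K S hE v _ _).trans ?_
    -- RHS: the vector of the composite IS `π_v (σ⁻¹ • [x]_E)` (all `rfl`: -w4 `conjCoeff_hom_hom_apply`, -w7 `comapLayerHom_hom_apply_coe`,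
    -- P2-a `coe_toLayerIS`, -w6 `idelePiPlaceSD_inr_hom_hom_apply` / `finIdelePiS_apply`, w3 g17 `coe_truncIdeleBarRepr_mk_apply`)
    change _ = (unitsVal (v.adicCompletion K)
      (finIdelePi v ((ideleData K).toSystem.rep σ⁻¹ (ofTruncIdele S x))) : AlgebraicClosure (v.adicCompletion K))
    -- `σ⁻¹ • [x]_E = [σ⁻¹|_E • x]_E` (`rep_of`) and `π_v [y]_E = π_v^{E} y` (`finIdelePi_of`); no `rw`: explicit chain
    refine Eq.trans ?_ (congrArg (fun z => (unitsVal (v.adicCompletion K) (finIdelePi v z) : AlgebraicClosure (v.adicCompletion K)))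
      ((ideleData K).toSystem.rep_of σ⁻¹ E (inclIS S E x))).symm
    refine Eq.trans ?_ (congrArg (fun z => (unitsVal (v.adicCompletion K) z : AlgebraicClosure (v.adicCompletion K)))
      (finIdelePi_of v E _)).symm
    -- both sides are `placeEmb_ι` of a transported component of the truncated idèle `x`
    change placeEmb v E.1.val _ = placeEmb v E.1.val
      (galAdicCompletionMap (E.restrictHom σ⁻¹) (smul_inv_smul (E.restrictHom σ⁻¹) _)
        ((((Additive.toMul x : IdeleHerbrand.truncIdeles K E.1 S) : ideleGroup E.1) : AdeleRing (𝓞 E.1) E.1).2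
          ((E.restrictHom σ⁻¹)⁻¹ • ((embPlace v E.1.val : Place K E.1 v) : HeightOneSpectrum (𝓞 E.1)))))
    have hg : (restrictHomS S hE (QuotientGroup.mk σ))⁻¹ = E.restrictHom σ⁻¹ := by
      rw [restrictHomS_mk, map_inv]
    have hw : ((locPlaceOver K S U hE v (QuotientGroup.mk σ) u hu : Place (locFixedField K S U hE) E.1 u) :
          HeightOneSpectrum (𝓞 E.1)) =
        (E.restrictHom σ⁻¹)⁻¹ • ((embPlace v E.1.val : Place K E.1 v) : HeightOneSpectrum (𝓞 E.1)) := by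
      rw [coe_locPlaceOver, coe_locPlace_eq_smul, restrictHomS_mk, map_inv, inv_inv]
    have h2 : E.restrictHom σ⁻¹ •
        ((locPlaceOver K S U hE v (QuotientGroup.mk σ) u hu : Place (locFixedField K S U hE) E.1 u) : HeightOneSpectrum (𝓞 E.1)) =
          ((embPlace v E.1.val : Place K E.1 v) : HeightOneSpectrum (𝓞 E.1)) := by
      rw [hw, smul_inv_smul]
    exact congrArg (placeEmb v E.1.val)
      ((galAdicCompletionMap_congr_left E.1 hg _ h2 _).trans
        (galAdicCompletionMap_apply_congr_place E.1 hw h2 _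
          (fun w : HeightOneSpectrum (𝓞 E.1) =>
            ((((Additive.toMul x : IdeleHerbrand.truncIdeles K E.1 S) : ideleGroup E.1) : AdeleRing (𝓞 E.1) E.1).2 w))))

set_option maxHeartbeats 1600000 in
-- the one `refine` below elaborates five compatible pairs over the completed local layer at once (≈ 4× the default budget)
/-- **The `(w,t) ↔ u` square**: LEAD's finite-level local datum `locLayerClass (inr v, t) c`, carried by bsd-line-x1-p1-w3's
local identification `Hⁿ(V_v ⧸ N_{v,s_t}, (K̄_vˣ)^{N}) ≅ Hⁿ(Gal(E_{w_{s_t}}/L_u), E_{w_{s_t}}ˣ)`, IS the single pull-back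
`Hⁿ(truncLocGroupHom, truncLocCoeffHom) c` of `c` at the place `w_{s_t} ∣ u` — i.e. (`shapiroAut_placeProj_truncComponentClass_eq_map`)
the Shapiro image of the `u`-component of `c`. Five `groupCohomology.map`s collapse to one (`map_comp`), and the two compatible pairs
agree pointwise by the two dictionaries above. [cite: CasselsFrohlichANT1967, Ch. VII §7.2–§7.3][cite: Harari2020, §17.5 Prop. 17.25 (proof)] -/
theorem locLayerCohomologyIsoAut_hom_locLayerClass_eq_map (hv : v ∈ S)
    (t : DoubleCosets (decompMapPlaceS K S (Sum.inr v : Place K)) U)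
    (hut : haveI := E.numberField; haveI := E.isGalois;
      (locPlace K S hE v (dcRep (decompMapPlaceS K S (Sum.inr v : Place K)) U t) : HeightOneSpectrum (𝓞 E.1)).under
        (𝓞 (locFixedField K S U hE)) = u)
    (n : ℕ) (c : groupCohomology (haveI := E.numberField;
      Rep.res (subgroupImageS S hE U).subtype (IdeleHerbrand.truncRep K E.1 S)) n) :
    haveI := E.numberField; haveI := E.isGalois;
    (locLayerCohomologyIsoAut K S U hE hEU v (dcRep (decompMapPlaceS K S (Sum.inr v : Place K)) U t) u hut n).hom
        (locLayerClass K S U ⟨Sum.inr v, hv⟩ t hE hEU n c) =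
      groupCohomology.map
        (IdeleHerbrand.truncLocGroupHom (subgroupImageS S hE U)
          (locPlaceOver K S U hE v (dcRep (decompMapPlaceS K S (Sum.inr v : Place K)) U t) u hut))
        (IdeleHerbrand.truncLocCoeffHom S (subgroupImageS S hE U)
          (locPlaceOver K S U hE v (dcRep (decompMapPlaceS K S (Sum.inr v : Place K)) U t) u hut)) n c := by
  haveI := E.numberField
  haveI := E.isGalois
  -- LEAD's `locLayerClass` at `w = inr v`, unfolded (definitional)
  have e1 : locLayerClass K S U ⟨Sum.inr v, hv⟩ t hE hEU n c =
      groupCohomology.map (MonoidHom.id _)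
        ((invariantsQuotFunctor ℤ
            (comapOpenNormalSubgroup (conjHom (decompMapPlaceS K S (Sum.inr v : Place K)) U (dcRep (decompMapPlaceS K S (Sum.inr v : Place K)) U t))
              (continuous_conjHom (decompMapPlaceS K S (Sum.inr v : Place K)) (continuous_decompMapPlaceS K S _) U _)
              (traceOpenNormalSubgroup U (layerSubgroupS S E)) : Subgroup ↥(U.comap (decompMapPlaceS K S (Sum.inr v : Place K))))).map
          (conjCoeff (decompMapPlaceS K S (Sum.inr v : Place K)) (continuous_decompMapPlaceS K S _) U (truncIdeleBarD K S)
            (unitsD (Place.Completion (Sum.inr v : Place K))) (locQ K S ⟨Sum.inr v, hv⟩) (dcRep (decompMapPlaceS K S (Sum.inr v : Place K)) U t) (k := ℤ))) n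
        (groupCohomology.map
          (quotComapMap (conjHom (decompMapPlaceS K S (Sum.inr v : Place K)) U (dcRep (decompMapPlaceS K S (Sum.inr v : Place K)) U t))
          (continuous_conjHom (decompMapPlaceS K S (Sum.inr v : Place K)) (continuous_decompMapPlaceS K S _) U _)
          (traceOpenNormalSubgroup U (layerSubgroupS S E)))
          (comapLayerHom (conjHom (decompMapPlaceS K S (Sum.inr v : Place K)) U (dcRep (decompMapPlaceS K S (Sum.inr v : Place K)) U t))
              (continuous_conjHom (decompMapPlaceS K S (Sum.inr v : Place K)) (continuous_decompMapPlaceS K S _) U _)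
              (traceOpenNormalSubgroup U (layerSubgroupS S E)) ((resD ℤ U).obj (truncIdeleBarD K S))) n
          ((relLayerISCohomologyIso S U hE hEU n).inv c)) := rfl
  -- the three isomorphisms as `groupCohomology.map`s (Mathlib `mapIso_hom` / `mapIso_inv`)
  have hI₁ : (relLayerISCohomologyIso S U hE hEU n).inv = _ :=
    groupCohomology.mapIso_inv (subgroupImageSEquiv S hE U) (relLayerISEquiv S U hE hEU) (relLayerISEquiv_comm S U hE hEU) n
  have hI₄ : (locLayerCohomologyIso K S U hE hEU v (dcRep (decompMapPlaceS K S (Sum.inr v : Place K)) U t) u hut n).hom = _ :=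
    groupCohomology.mapIso_hom (locDecompEquiv K S U hE hEU v _ u hut) (locUnitsEquiv K S U hE hEU v _ u hut)
      (locUnitsEquiv_comm K S U hE hEU v _ u hut) n
  have hI₅ : (groupCohomologyLocalUnitsRepIso
      (locPlaceOver K S U hE v (dcRep (decompMapPlaceS K S (Sum.inr v : Place K)) U t) u hut) n).hom = _ :=
    groupCohomology.mapIso_hom
      (A := Rep.ofAlgebraAutOnUnits (u.adicCompletion (locFixedField K S U hE))
        ((locPlaceOver K S U hE v (dcRep (decompMapPlaceS K S (Sum.inr v : Place K)) U t) u hut :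
          HeightOneSpectrum (𝓞 E.1)).adicCompletion E.1))
      (B := localUnitsRep (locPlaceOver K S U hE v (dcRep (decompMapPlaceS K S (Sum.inr v : Place K)) U t) u hut))
      (decompMulEquiv (locPlaceOver K S U hE v _ u hut)) (LinearEquiv.refl ℤ _) (fun _ => rfl) n
  refine (congrArg (locLayerCohomologyIsoAut K S U hE hEU v (dcRep (decompMapPlaceS K S (Sum.inr v : Place K)) U t) u hut n).hom
    e1).trans (IdeleHerbrand.iso_hom_map_map_iso_inv_eq_map_apply _ _
      (quotComapMap (conjHom (decompMapPlaceS K S (Sum.inr v : Place K)) U (dcRep (decompMapPlaceS K S (Sum.inr v : Place K)) U t))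
          (continuous_conjHom (decompMapPlaceS K S (Sum.inr v : Place K)) (continuous_decompMapPlaceS K S _) U _)
          (traceOpenNormalSubgroup U (layerSubgroupS S E)))
      (comapLayerHom (conjHom (decompMapPlaceS K S (Sum.inr v : Place K)) U (dcRep (decompMapPlaceS K S (Sum.inr v : Place K)) U t))
              (continuous_conjHom (decompMapPlaceS K S (Sum.inr v : Place K)) (continuous_decompMapPlaceS K S _) U _)
              (traceOpenNormalSubgroup U (layerSubgroupS S E)) ((resD ℤ U).obj (truncIdeleBarD K S)))
      (MonoidHom.id _)
      ((invariantsQuotFunctor ℤ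
            (comapOpenNormalSubgroup (conjHom (decompMapPlaceS K S (Sum.inr v : Place K)) U (dcRep (decompMapPlaceS K S (Sum.inr v : Place K)) U t))
              (continuous_conjHom (decompMapPlaceS K S (Sum.inr v : Place K)) (continuous_decompMapPlaceS K S _) U _)
              (traceOpenNormalSubgroup U (layerSubgroupS S E)) : Subgroup ↥(U.comap (decompMapPlaceS K S (Sum.inr v : Place K))))).map
          (conjCoeff (decompMapPlaceS K S (Sum.inr v : Place K)) (continuous_decompMapPlaceS K S _) U (truncIdeleBarD K S)
            (unitsD (Place.Completion (Sum.inr v : Place K))) (locQ K S ⟨Sum.inr v, hv⟩) (dcRep (decompMapPlaceS K S (Sum.inr v : Place K)) U t) (k := ℤ))) _ _ _ _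
      (IdeleHerbrand.truncLocGroupHom (subgroupImageS S hE U)
        (locPlaceOver K S U hE v (dcRep (decompMapPlaceS K S (Sum.inr v : Place K)) U t) u hut))
      (IdeleHerbrand.truncLocCoeffHom S (subgroupImageS S hE U)
        (locPlaceOver K S U hE v (dcRep (decompMapPlaceS K S (Sum.inr v : Place K)) U t) u hut))
      (fun g => ?_) (fun x => ?_) n _ hI₁ _ hI₄ _ hI₅ c)
  · exact truncLocGroupHom_eq_subgroupImageSEquiv K S U hE hEU v _ u hut g
  · exact truncLocCoeffHom_hom_eq_locUnitsEquiv K S U hE hEU v _ u hut hv x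

/-- Vanishing form of the square: if LEAD's `locLayerClass (inr v, t) c = 0` then the `u`-component of `c` vanishes, for every
finite place `u` of `L = E^{H_E}` under `w_{s_t}`. [cite: CasselsFrohlichANT1967, Ch. VII §7.3][cite: Harari2020, §17.5 Prop. 17.25] -/
theorem placeComponent_truncComponentClass_eq_zero_of_locLayerClass_eq_zero (hv : v ∈ S)
    (t : DoubleCosets (decompMapPlaceS K S (Sum.inr v : Place K)) U)
    (hut : haveI := E.numberField; haveI := E.isGalois;
      (locPlace K S hE v (dcRep (decompMapPlaceS K S (Sum.inr v : Place K)) U t) : HeightOneSpectrum (𝓞 E.1)).under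
        (𝓞 (locFixedField K S U hE)) = u)
    (n : ℕ) (c : groupCohomology (haveI := E.numberField;
      Rep.res (subgroupImageS S hE U).subtype (IdeleHerbrand.truncRep K E.1 S)) n)
    (hc : haveI := E.numberField; locLayerClass K S U ⟨Sum.inr v, hv⟩ t hE hEU n c = 0) :
    haveI := E.numberField; haveI := E.isGalois;
    groupCohomology.map (MonoidHom.id _) (IdeleCohomology.placeProj (E := E.1) u) n
      (IdeleHerbrand.truncComponentClass S (subgroupImageS S hE U) n c) = 0 := by
  haveI := E.numberField
  haveI := E.isGalois
  have hsq := locLayerCohomologyIsoAut_hom_locLayerClass_eq_map K S U hE hEU v u hv t hut n c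
  have h0 : (locLayerCohomologyIsoAut K S U hE hEU v (dcRep (decompMapPlaceS K S (Sum.inr v : Place K)) U t) u hut n).hom
      (locLayerClass K S U ⟨Sum.inr v, hv⟩ t hE hEU n c) = 0 :=
    (IdeleHerbrand.iso_hom_apply_eq_zero_iff _ _).2 hc
  -- the Shapiro image of the `u`-component is `0`, hence so is the component (explicit chain, no `rw`)
  have h3 := (IdeleHerbrand.shapiroAut_placeProj_truncComponentClass_eq_map S (subgroupImageS S hE U) n
    (locPlaceOver K S U hE v (dcRep (decompMapPlaceS K S (Sum.inr v : Place K)) U t) u hut) c).trans (hsq.symm.trans h0)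
  exact (IdeleHerbrand.iso_hom_apply_eq_zero_iff _ _).1 h3

end IdeleReadout

/-! ## §4. The export: a class with vanishing local-layer data is zero (totally complex base) -/

namespace IdeleClassBar

open IdeleReadout SemiLocal Literature.Algebra.Homology.DiscreteRep
open Literature.NumberTheory.GaloisRepresentations.LocalWeilDatum (galFixing)

/-- **[P2-mono] at finite level (Harari Prop. 17.25 / Milne I Lemma 4.13, `r = 2`, on the layer `E`; Tate C–F VII §7.3)**, in
LEAD bsd-line-x1-p1's currency: over a TOTALLY COMPLEX `K`, a class `c ∈ H²(H_E, Res_{H_E} J_{E,S})` all of whose finite-level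
local data `locLayerClass (w, t) c` (`w ∣ S ∪ ∞`, `t ∈ U\G_S/φ_w Γ_{K_w}`) vanish is zero.  Proof: by Tate VII 7.3 at the subgroup
`H_E` (`eq_zero_of_finitePlaceComponents_eq_zero_above`; the archimedean components vanish since every infinite place of `L = E^{H_E}`
is complex) it suffices that the `u`-component of `c` vanish for every finite place `u` of `L` above `S`; by bsd-line-x1-p1-w7's
`exists_dcRep_smul_embPlace_under_eq_self` such a `u` lies under `w_{s_t} = (s_t|_E) • w̄_E` for some double coset `t` at
`v = u ∩ 𝓞 K ∈ S`, and there the `(w,t) ↔ u` square applies. [cite: Harari2020, §17.5 Prop. 17.25][cite: MilneADT2006, I Lemma 4.13]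
[cite: CasselsFrohlichANT1967, Ch. VII §7.3 Prop. 7.3] -/
theorem eq_zero_of_forall_locLayerClass_eq_zero {K : Type} [Field K] [NumberField K] [IsTotallyComplex K]
    (S : Finset (HeightOneSpectrum (𝓞 K)))
    (U : Subgroup (GaloisGroupUnramifiedOutside K (↑S : Set (HeightOneSpectrum (𝓞 K))))) [U.Normal]
    (E : GalLayer K) (hE : ramificationSubgroup K (↑S : Set (HeightOneSpectrum (𝓞 K))) ≤ galFixing K E.1)
    (hEU : (layerSubgroupS S E : Subgroup (GaloisGroupUnramifiedOutside K (↑S : Set (HeightOneSpectrum (𝓞 K))))) ≤ U)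
    (c : groupCohomology (haveI := E.numberField;
      Rep.res (subgroupImageS S hE U).subtype (IdeleHerbrand.truncRep K E.1 S)) 2)
    (h : haveI := E.numberField;
      ∀ (w : OverS K S) (t : DoubleCosets (decompMapPlaceS K S w.1) U), locLayerClass K S U w t hE hEU 2 c = 0) :
    c = 0 := by
  haveI := E.numberField
  haveI := E.isGalois
  refine IdeleHerbrand.eq_zero_of_finitePlaceComponents_eq_zero_above S (subgroupImageS S hE U) 1 c fun u hu => ?_
  obtain ⟨t, ht⟩ := exists_dcRep_smul_embPlace_under_eq_self K S U hE u
  -- `w_{s_t} = (s_t|_E) • w̄_E` (bsd-line-x1-p1-w3's `coe_locPlace_eq_smul`), so `u` lies under `w_{s_t}`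
  exact placeComponent_truncComponentClass_eq_zero_of_locLayerClass_eq_zero K S U hE hEU (u.under (𝓞 K)) u hu t
    ((congrArg (fun w : HeightOneSpectrum (𝓞 E.1) =>
      w.under (𝓞 (IntermediateField.fixedField (subgroupImageS S hE U)))) (coe_locPlace_eq_smul K S hE (u.under (𝓞 K))
        (dcRep (decompMapPlaceS K S (Sum.inr (u.under (𝓞 K)) : Place K)) U t))).trans ht) 2 c
    (h ⟨Sum.inr (u.under (𝓞 K)), hu⟩ t)

end IdeleClassBar

end Literature.NumberTheory.GaloisRepresentations

end
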